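import Summits.QuantumAdvantage.AdviceFreeQNC0.DWalkNormalForm
import Mathlib.GroupTheory.Perm.Basic
import Mathlib.Data.Fintype.Perm
import HarnessLib

/-!
# Cell qa-qnc0 (rung F-Q2-odd, `p = 3`): the D-walk as a word in `AGL(1,𝔽₃) ≅ S₃` — letters, products, fibres

Planner qa-qnc0-p1 g16, `ROUND-15.md` §1 (formalisation map L1–L2), for THEOREM A′ `PredHardDWB3`
(`DWalkNormalForm.lean`).  Everything here is finite group bookkeeping, no probability:

* LETTERS.  `yt b = ±1` (`+1` iff the bit is `1`); the letter of a position with weight `κ` and bit `b` is the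
  affine permutation `letter κ b : z ↦ ỹ z + κ ỹ` of `𝔽₃` (`Equiv.Perm (ZMod 3)`): the ROTATION `z ↦ z + κ` if
  `b = 1`, the REFLECTION `z ↦ -z - κ` if `b = 0` (a zero of the pattern = a domain wall = a reflection).
  `IsAff P e t` (`P z = e z + t`) is multiplicative: `(e,t)·(e',t') = (e e', t + e t')` (`IsAff.mul`).
* WORDS.  `wp κ x a l = letter_a · letter_{a+1} ⋯ letter_{a+l-1}` (ℕ-indexed, LAST letter applied first), with
  `wp_add` (concatenation = product) and `wp_congr` (locality); its sign `sgnW` (product of the `ỹ`, i.e. the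
  walk spin `(-1)^{u}`) and translation `trW = Σ_i κ_i s_i` (`isAff_wp`, `trW_eq_sum`).
* DICTIONARY (L1).  For a pattern `x ∈ {0,1}^{n+1}` and a cut `k ≤ n`: **`Dk3 x k = trW (kappa k) (xN x) 0 n`**
  (`dk3_eq_trW`) — the stake is the TRANSLATION PART of the word of the first `n` letters with weights
  `κ_i = 2 (i < k), 1 (i ≥ k)`; and the window decomposition `trW 0 n = t_p + e_p (T + E t_s)` (`trW_window`).
* Every permutation of `𝔽₃` is affine (`perm_isAff`).  The fibre counts (L2) are `DWalkFibres.lean`.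

WHAT THIS IS NOT: no gauge, no transport, no hardness statement here (those are the next files of the line);
separation NOT moved.
-/

noncomputable section

namespace Summit.QuantumAdvantage.AdviceFreeQNC0

namespace DWalk

open Finset Equiv

/-! ### Letters: affine permutations of `𝔽₃` -/

/-- `ỹ(b) = +1` for `b = 1`, `−1` for `b = 0` (`ỹ = (−1)^{¬b}`). -/
def yt (b : Bool) : ZMod 3 := if b then 1 else -1

/-- `ỹ² = 1`. -/
@[simp] theorem yt_mul_self (b : Bool) : yt b * yt b = 1 := by cases b <;> decide

/-- `ỹ ∈ {1, −1}`. -/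
theorem yt_eq_or (b : Bool) : yt b = 1 ∨ yt b = -1 := by cases b <;> simp [yt]

/-- The letter of a position with weight `κ` and bit `b`: `z ↦ ỹ z + κ ỹ` (rotation by `κ` if `b = 1`,
reflection `z ↦ −z − κ` if `b = 0`). -/
def letter (κ : ZMod 3) (b : Bool) : Perm (ZMod 3) where
  toFun z := yt b * z + κ * yt b
  invFun z := yt b * z - κ
  left_inv z := by
    show yt b * (yt b * z + κ * yt b) - κ = z
    have h := yt_mul_self b
    linear_combination (z + κ) * h
  right_inv z := by
    show yt b * (yt b * z - κ) + κ * yt b = z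
    have h := yt_mul_self b
    linear_combination z * h

/-- `letter κ b z = ỹ z + κ ỹ`. -/
theorem letter_apply (κ : ZMod 3) (b : Bool) (z : ZMod 3) : letter κ b z = yt b * z + κ * yt b := rfl

/-- `P` is the affine map `z ↦ e z + t`. -/
def IsAff (P : Perm (ZMod 3)) (e t : ZMod 3) : Prop := ∀ z, P z = e * z + t

/-- The identity is `(1, 0)`. -/
theorem isAff_one : IsAff 1 1 0 := fun z => by simp

/-- Letters are affine: `(ỹ, κỹ)`. -/
theorem isAff_letter (κ : ZMod 3) (b : Bool) : IsAff (letter κ b) (yt b) (κ * yt b) := fun _ => rfl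

/-- **Composition law** `(e,t)·(e',t') = (e e', t + e t')` (the right factor is applied first). -/
theorem IsAff.mul {P Q : Perm (ZMod 3)} {e t e' t' : ZMod 3} (hP : IsAff P e t) (hQ : IsAff Q e' t') :
    IsAff (P * Q) (e * e') (t + e * t') := fun z => by
  rw [Perm.mul_apply, hQ, hP]; ring

/-- The translation part is the value at `0`. -/
theorem IsAff.apply_zero {P : Perm (ZMod 3)} {e t : ZMod 3} (h : IsAff P e t) : P 0 = t := by
  rw [h]; ring

/-- The affine data of a permutation are unique. -/
theorem IsAff.unique {P : Perm (ZMod 3)} {e t e' t' : ZMod 3} (h : IsAff P e t) (h' : IsAff P e' t') :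
    e = e' ∧ t = t' := by
  have h0 := h 0; have h0' := h' 0; have h1 := h 1; have h1' := h' 1
  simp only [mul_zero, zero_add, mul_one] at h0 h0' h1 h1'
  constructor
  · rw [h1] at h1'; rw [h0] at h0'; linear_combination h1' - h0'
  · rw [h0] at h0'; exact h0'

/-- Two permutations with the same affine data are equal. -/
theorem IsAff.perm_eq {P Q : Perm (ZMod 3)} {e t : ZMod 3} (h : IsAff P e t) (h' : IsAff Q e t) : P = Q :=
  Equiv.ext fun z => by rw [h, h']

/-- **Every permutation of `𝔽₃` is affine**, with sign `P 1 − P 0 ∈ {±1}` and translation `P 0`. -/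
theorem perm_isAff (P : Perm (ZMod 3)) :
    IsAff P (P 1 - P 0) (P 0) ∧ (P 1 - P 0 = 1 ∨ P 1 - P 0 = -1) := by
  have hinj : Function.Injective P := P.injective
  have h01 : P 0 ≠ P 1 := fun h => absurd (hinj h) (by decide)
  have h02 : P 0 ≠ P 2 := fun h => absurd (hinj h) (by decide)
  have h12 : P 1 ≠ P 2 := fun h => absurd (hinj h) (by decide)
  have key : ∀ a b c : ZMod 3, a ≠ b → a ≠ c → b ≠ c →
      (c = (b - a) * 2 + a ∧ (b - a = 1 ∨ b - a = -1)) := by decide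
  obtain ⟨hk1, hk2⟩ := key (P 0) (P 1) (P 2) h01 h02 h12
  refine ⟨fun z => ?_, hk2⟩
  have hz : ∀ z : ZMod 3, z = 0 ∨ z = 1 ∨ z = 2 := by decide
  rcases hz z with rfl | rfl | rfl
  · ring
  · ring
  · exact hk1

/-! ### Words (ℕ-indexed) -/

/-- The word `letter_a · letter_{a+1} ⋯ letter_{a+l-1}` of the letters at positions `a, …, a+l-1`
(weights `κ`, bits `x`); the LAST letter is applied first. -/
def wp (κ : ℕ → ZMod 3) (x : ℕ → Bool) (a : ℕ) : ℕ → Perm (ZMod 3)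
  | 0 => 1
  | l + 1 => wp κ x a l * letter (κ (a + l)) (x (a + l))

/-- The sign of the word: `Π_{i<l} ỹ_{a+i}` (the relative spin after `l` letters). -/
def sgnW (x : ℕ → Bool) (a : ℕ) : ℕ → ZMod 3
  | 0 => 1
  | l + 1 => sgnW x a l * yt (x (a + l))

/-- The translation of the word: `Σ_{i<l} κ_{a+i}·(Π_{j≤i} ỹ_{a+j})`. -/
def trW (κ : ℕ → ZMod 3) (x : ℕ → Bool) (a : ℕ) : ℕ → ZMod 3
  | 0 => 0
  | l + 1 => trW κ x a l + κ (a + l) * sgnW x a (l + 1)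

/-- The empty word is the identity. -/
@[simp] theorem wp_zero (κ : ℕ → ZMod 3) (x : ℕ → Bool) (a : ℕ) : wp κ x a 0 = 1 := rfl
/-- Unfolding: one more letter on the right. -/
theorem wp_succ (κ : ℕ → ZMod 3) (x : ℕ → Bool) (a l : ℕ) :
    wp κ x a (l + 1) = wp κ x a l * letter (κ (a + l)) (x (a + l)) := rfl
/-- The empty word has sign `1`. -/
@[simp] theorem sgnW_zero (x : ℕ → Bool) (a : ℕ) : sgnW x a 0 = 1 := rfl
/-- Unfolding of the sign. -/
theorem sgnW_succ (x : ℕ → Bool) (a l : ℕ) : sgnW x a (l + 1) = sgnW x a l * yt (x (a + l)) := rfl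
/-- The empty word has translation `0`. -/
@[simp] theorem trW_zero (κ : ℕ → ZMod 3) (x : ℕ → Bool) (a : ℕ) : trW κ x a 0 = 0 := rfl
/-- Unfolding of the translation. -/
theorem trW_succ (κ : ℕ → ZMod 3) (x : ℕ → Bool) (a l : ℕ) :
    trW κ x a (l + 1) = trW κ x a l + κ (a + l) * sgnW x a (l + 1) := rfl

/-- The sign is `±1`. -/
theorem sgnW_eq_or (x : ℕ → Bool) (a : ℕ) : ∀ l, sgnW x a l = 1 ∨ sgnW x a l = -1
  | 0 => Or.inl rfl
  | l + 1 => by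
    rw [sgnW_succ]
    rcases sgnW_eq_or x a l with h | h <;> rcases yt_eq_or (x (a + l)) with h' | h' <;>
      rw [h, h'] <;> decide

/-- `(sign)² = 1`. -/
theorem sgnW_mul_self (x : ℕ → Bool) (a l : ℕ) : sgnW x a l * sgnW x a l = 1 := by
  rcases sgnW_eq_or x a l with h | h <;> rw [h] <;> decide

/-- **The word is affine with data `(sgnW, trW)`.** -/
theorem isAff_wp (κ : ℕ → ZMod 3) (x : ℕ → Bool) (a : ℕ) : ∀ l, IsAff (wp κ x a l) (sgnW x a l) (trW κ x a l)
  | 0 => isAff_one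
  | l + 1 => by
    intro z
    rw [wp_succ, sgnW_succ, trW_succ, sgnW_succ, (isAff_wp κ x a l).mul (isAff_letter _ _) z]
    ring

/-- **Concatenation**: `wp a (l₁ + l₂) = wp a l₁ · wp (a + l₁) l₂`. -/
theorem wp_add (κ : ℕ → ZMod 3) (x : ℕ → Bool) (a l₁ : ℕ) :
    ∀ l₂, wp κ x a (l₁ + l₂) = wp κ x a l₁ * wp κ x (a + l₁) l₂
  | 0 => by simp
  | l₂ + 1 => by
    rw [← Nat.add_assoc, wp_succ, wp_add κ x a l₁ l₂, wp_succ, mul_assoc, Nat.add_assoc]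

/-- **Locality**: the word depends only on the letters in its range. -/
theorem wp_congr {κ κ' : ℕ → ZMod 3} {x x' : ℕ → Bool} {a a' : ℕ} :
    ∀ {l : ℕ}, (∀ t, t < l → κ (a + t) = κ' (a' + t) ∧ x (a + t) = x' (a' + t)) →
      wp κ x a l = wp κ' x' a' l
  | 0, _ => rfl
  | l + 1, h => by
    rw [wp_succ, wp_succ, wp_congr (l := l) fun t ht => h t (Nat.lt_succ_of_lt ht), (h l (Nat.lt_succ_self l)).1,
      (h l (Nat.lt_succ_self l)).2]

/-- Locality of the sign. -/
theorem sgnW_congr {x x' : ℕ → Bool} {a a' : ℕ} :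
    ∀ {l : ℕ}, (∀ t, t < l → x (a + t) = x' (a' + t)) → sgnW x a l = sgnW x' a' l
  | 0, _ => rfl
  | l + 1, h => by
    rw [sgnW_succ, sgnW_succ, sgnW_congr (l := l) fun t ht => h t (Nat.lt_succ_of_lt ht), h l (Nat.lt_succ_self l)]

/-- Locality of the translation. -/
theorem trW_congr {κ κ' : ℕ → ZMod 3} {x x' : ℕ → Bool} {a a' : ℕ} :
    ∀ {l : ℕ}, (∀ t, t < l → κ (a + t) = κ' (a' + t) ∧ x (a + t) = x' (a' + t)) →
      trW κ x a l = trW κ' x' a' l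
  | 0, _ => rfl
  | l + 1, h => by
    rw [trW_succ, trW_succ, trW_congr (l := l) fun t ht => h t (Nat.lt_succ_of_lt ht), (h l (Nat.lt_succ_self l)).1,
      sgnW_congr (l := l + 1) fun t ht => (h t ht).2]

/-- Closed form of the translation: `trW = Σ_{i<l} κ_{a+i}·sgnW (i+1)`. -/
theorem trW_eq_sum (κ : ℕ → ZMod 3) (x : ℕ → Bool) (a : ℕ) :
    ∀ l, trW κ x a l = ∑ i ∈ range l, κ (a + i) * sgnW x a (i + 1)
  | 0 => by simp
  | l + 1 => by rw [trW_succ, Finset.sum_range_succ, trW_eq_sum κ x a l]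

/-- Sign of a concatenation. -/
theorem sgnW_add (x : ℕ → Bool) (a l₁ : ℕ) : ∀ l₂, sgnW x a (l₁ + l₂) = sgnW x a l₁ * sgnW x (a + l₁) l₂
  | 0 => by simp
  | l₂ + 1 => by rw [← Nat.add_assoc, sgnW_succ, sgnW_add x a l₁ l₂, sgnW_succ, mul_assoc, Nat.add_assoc]

/-- Translation of a concatenation: `trW a (l₁+l₂) = trW a l₁ + sgnW a l₁ · trW (a+l₁) l₂`. -/
theorem trW_add (κ : ℕ → ZMod 3) (x : ℕ → Bool) (a l₁ l₂ : ℕ) :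
    trW κ x a (l₁ + l₂) = trW κ x a l₁ + sgnW x a l₁ * trW κ x (a + l₁) l₂ := by
  have h1 := isAff_wp κ x a (l₁ + l₂)
  have h2 := (isAff_wp κ x a l₁).mul (isAff_wp κ x (a + l₁) l₂)
  rw [← wp_add] at h2
  exact (h1.unique h2).2

/-- **Window decomposition of the translation**: for `a + w ≤ n`,
`trW 0 n = t_p + e_p·(T + E·t_s)` with prefix `(e_p, t_p)`, window `(E, T)`, suffix translation `t_s`. -/
theorem trW_window (κ : ℕ → ZMod 3) (x : ℕ → Bool) {a w n : ℕ} (h : a + w ≤ n) :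
    trW κ x 0 n = trW κ x 0 a + sgnW x 0 a * (trW κ x a w + sgnW x a w * trW κ x (a + w) (n - (a + w))) := by
  have h1 := trW_add κ x 0 a (n - a)
  rw [Nat.add_sub_cancel' (by omega : a ≤ n), Nat.zero_add] at h1
  have h2 := trW_add κ x a w (n - (a + w))
  rw [show w + (n - (a + w)) = n - a by omega] at h2
  rw [h1, h2]

/-! ### The dictionary: `Dk3` is the translation part of the word (L1) -/

/-- A pattern of length `n + 1` as an ℕ-indexed bit sequence (junk `false` beyond). -/
def xN {n : ℕ} (x : Fin (n + 1) → Bool) (i : ℕ) : Bool := if h : i < n + 1 then x ⟨i, h⟩ else false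

/-- The weights of the stake `D_k`: `κ_i = 2` for `i < k`, `1` for `i ≥ k`. -/
def kappa (k : ℕ) (i : ℕ) : ZMod 3 := if i < k then 2 else 1

/-- The weights are non-zero. -/
theorem kappa_ne_zero (k i : ℕ) : kappa k i ≠ 0 := by
  unfold kappa; split_ifs <;> decide

/-- `sgn3 (a ⊕ ¬b) = sgn3 a · ỹ(b)`. -/
theorem sgn3_xor_not (a b : Bool) : sgn3 (xor a (!b)) = sgn3 a * yt b := by
  cases a <;> cases b <;> decide

/-- **The walk spin is the sign of the prefix word**: `sgn3 (zpar x i) = sgnW (xN x) 0 i` (`i ≤ n + 1`). -/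
theorem sgn3_zpar_eq_sgnW {n : ℕ} (x : Fin (n + 1) → Bool) : ∀ i, i ≤ n + 1 → sgn3 (zpar x i) = sgnW (xN x) 0 i
  | 0, _ => by rw [zpar_zero]; rfl
  | i + 1, hi => by
    rw [zpar_succ x (show i < n + 1 by omega), sgnW_succ, sgn3_xor_not, sgn3_zpar_eq_sgnW x i (by omega),
      Nat.zero_add]
    congr 2
    simp [xN, show i < n + 1 by omega]

/-- `M_k` as a sum of prefix signs: `Mk3 x k = Σ_{i<k} sgnW (xN x) 0 (i+1)` for `k ≤ n + 1`. -/
theorem mk3_eq_sum {n : ℕ} (x : Fin (n + 1) → Bool) {k : ℕ} (hk : k ≤ n + 1) :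
    Mk3 x k = ∑ i ∈ range k, sgnW (xN x) 0 (i + 1) := by
  unfold Mk3
  have h1 : (∑ i ∈ univ.filter (fun i : Fin (n + 1) => i.val < k), sgn3 (uCoord x i)) =
      ∑ i : Fin (n + 1), (if i.val < k then sgnW (xN x) 0 (i.val + 1) else 0) := by
    rw [Finset.sum_filter]
    refine Finset.sum_congr rfl fun i _ => ?_
    split_ifs with h
    · rw [uCoord_eq_zpar, sgn3_zpar_eq_sgnW x (i.val + 1) (by omega)]
    · rfl
  rw [h1, Fin.sum_univ_eq_sum_range (fun i => if i < k then sgnW (xN x) 0 (i + 1) else 0) (n + 1),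
    ← Finset.sum_filter]
  congr 1
  ext i
  simp only [mem_filter, mem_range]
  omega

/-- **Dictionary theorem (L1)**: for a cut `k ≤ n`, the stake `D_k` of a pattern `x ∈ {0,1}^{n+1}` is the
TRANSLATION PART of the word of its first `n` letters with weights `kappa k`:
`Dk3 x k = trW (kappa k) (xN x) 0 n = (wp (kappa k) (xN x) 0 n) 0`. -/
theorem dk3_eq_trW {n : ℕ} (x : Fin (n + 1) → Bool) {k : ℕ} (hk : k ≤ n) :
    Dk3 x k = trW (kappa k) (xN x) 0 n := by
  unfold Dk3
  rw [Nat.add_sub_cancel, mk3_eq_sum x (by omega), mk3_eq_sum x (by omega), trW_eq_sum]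
  simp only [Nat.zero_add, kappa]
  -- `Σ_{i<k} s + Σ_{i<n} s = Σ_{i<n} (if i<k then 2 else 1)·s`
  have hsplit : ∑ i ∈ range n, (if i < k then (2 : ZMod 3) else 1) * sgnW (xN x) 0 (i + 1) =
      ∑ i ∈ range n, sgnW (xN x) 0 (i + 1) + ∑ i ∈ range n, (if i < k then sgnW (xN x) 0 (i + 1) else 0) := by
    rw [← Finset.sum_add_distrib]
    refine Finset.sum_congr rfl fun i _ => ?_
    split_ifs <;> ring
  rw [hsplit, ← Finset.sum_filter, add_comm]
  congr 1
  congr 1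
  ext i
  simp only [mem_filter, mem_range]
  omega

/-- The stake as the value at `0` of the word. -/
theorem dk3_eq_wp_zero {n : ℕ} (x : Fin (n + 1) → Bool) {k : ℕ} (hk : k ≤ n) :
    Dk3 x k = (wp (kappa k) (xN x) 0 n) 0 := by
  rw [dk3_eq_trW x hk, (isAff_wp (kappa k) (xN x) 0 n).apply_zero]

end DWalk

end Summit.QuantumAdvantage.AdviceFreeQNC0

end
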